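import Mathlib
import HarnessLib
import Summits.HubbardSuperconductivity.HubbardSuperconductivity.Theorems.WeakCouplingBCSKlCertB1gWindowD010D020
import Summits.HubbardSuperconductivity.HubbardSuperconductivity.Theorems.WeakCouplingBCSDefsKlCertB1gWinZRecord
import Summits.HubbardSuperconductivity.HubbardSuperconductivity.Theorems.WeakCouplingBCSDefsKlCertB1gWinDRecord

/-!
# Route `WeakCouplingBCS` — support item `WcbcsKohnLuttingerB1g` (stmt-HubbardSuperconductivity-0158):
# `B1g` dominance on the EXTENDED chemical-potential window `μ ∈ [-0.5725, -0.075]` (hole dopings `δ ∈ [0.05, 0.25]`)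

The window records `klCertB1gWinZ` (`μ ∈ [-0.5725, -0.42749]`, 29 boxes, this seat), the glued margin-2 window
`klb1g_window_d010_d020` (`[-0.42749, -0.1775]`, records `klCertB1gWin{A,B,C}`, 44 boxes) and `klCertB1gWinD` (`[-0.1775, -0.075]`, 28 boxes,
this seat) are adjacent; each record is accepted by the multiplicity-aware checker (`decide +kernel` in its own file) and certifies, modulo
its named enclosures, μ-uniform `B1g` dominance on its window (`klb1gd_window_U`).  Gluing twice (`klb1gd_dominance_union`) gives the
statement on the union: for every `μ ∈ [-0.5725, -0.075]` — an interval containing the free-band chemical potentials of ALL hole dopings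
`δ ∈ [0.05, 0.25]` (certified monotone Riemann brackets of `δ(μ) = 1 - (2/π²)∫₀^π arccos⋆(-μ/2 - cos x) dx`: `δ(-0.5725) ∈ [0.25145, 0.25146]`,
`δ(-0.075) ∈ [0.048352, 0.048354]`; HOME/hubbard-kl-cert-2/MU-WINDOW-2.md) — every `0 < U < 1` and every channel `χ ≠ B1g`:
`channelInf ε₀ μ U B1g + γ U² ≤ channelInf ε₀ μ U χ` with `γ = min (min γ_Z γ_ABC) γ_D > 0`, `γ_ABC = min (min γ_A γ_B) γ_C`.
The hypotheses are the five named numerical statements `klCertB1gWin{Z,A,B,C,D}.EnclosuresB1g` (101 boxes × (E1, E2, 4 × E4) inequalities,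
each μ-uniform on its box), certified outside Lean by interval arithmetic in two independent implementations (gate cell `gate-hubbard-kl`,
HOME/MU-WINDOW.md and HOME/hubbard-kl-cert-2/MU-WINDOW-2.md).
-/

noncomputable section

-- the tree's namespace `Summit.<Summit>.<Problem>.Theorems` repeats the summit name by design (D-0017)
set_option linter.dupNamespace false

namespace Summit.HubbardSuperconductivity.HubbardSuperconductivity.Theorems

open Literature.MathematicalPhysics.QuantumLattice CwKLChiralWindow
open Summit.HubbardSuperconductivity.HubbardSuperconductivity.Theses.WeakCouplingBCS

/-- **`B1g` (`d_{x²-y²}`) dominance of the second-order Kohn–Luttinger vertex on the extended window `μ ∈ [-0.5725, -0.075]`**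
(⊃ `μ([0.05, 0.25])`), modulo the certified enclosures of the five window records: for every such `μ`, every `0 < U < 1` and every
`χ ≠ B1g`, `channelInf ε₀ μ U B1g + γ·U² ≤ channelInf ε₀ μ U χ` with `γ = min (min γ_Z γ_ABC) γ_D`, the record margins.
[cite: RaghuKivelsonScalapino2010, §III Fig. 2] -/
theorem klb1g_window_d005_d025 (hZ : klCertB1gWinZ.EnclosuresB1g) (hA : klCertB1gWinA.EnclosuresB1g)
    (hB : klCertB1gWinB.EnclosuresB1g) (hC : klCertB1gWinC.EnclosuresB1g) (hD : klCertB1gWinD.EnclosuresB1g) :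
    ∀ μ ∈ Set.Icc (-0.5725 : ℝ) (-0.075), ∀ U ∈ Set.Ioo (0 : ℝ) 1, ∀ χ : D4Irrep, χ ≠ D4Irrep.B1g →
      channelInf (squareDispersion 1 0) μ U D4Irrep.B1g +
          min (min ((klCertB1gWinZ.gamma : ℚ) : ℝ)
            (min (min ((klCertB1gWinA.gamma : ℚ) : ℝ) ((klCertB1gWinB.gamma : ℚ) : ℝ)) ((klCertB1gWinC.gamma : ℚ) : ℝ)))
            ((klCertB1gWinD.gamma : ℚ) : ℝ) * U ^ 2 ≤
        channelInf (squareDispersion 1 0) μ U χ := by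
  have hZw := klCertB1gWinZ_window_U hZ
  have hM := klb1g_window_d010_d020 hA hB hC
  have hDw := klCertB1gWinD_window_U hD
  have hloZ : (((klCertB1gWinZ).mub : ℚ) : ℝ) = -0.5725 := by
    show (((-229 : ℚ) / 400 : ℚ) : ℝ) = -0.5725
    norm_num
  have hhiZ : (((klCertB1gWinZ).mua : ℚ) : ℝ) = -0.42749 := by
    show (((-42749 : ℚ) / 100000 : ℚ) : ℝ) = -0.42749
    norm_num
  have hloD : (((klCertB1gWinD).mub : ℚ) : ℝ) = -0.1775 := by
    show (((-71 : ℚ) / 400 : ℚ) : ℝ) = -0.1775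
    norm_num
  have hhiD : (((klCertB1gWinD).mua : ℚ) : ℝ) = (-0.075) := by
    show (((-3 : ℚ) / 40 : ℚ) : ℝ) = (-0.075)
    norm_num
  rw [hloZ, hhiZ] at hZw
  rw [hloD, hhiD] at hDw
  have h1 := klb1gd_dominance_union (a₁ := (-0.5725 : ℝ)) (b₁ := (-0.42749 : ℝ)) (a₂ := (-0.42749 : ℝ)) (b₂ := (-0.1775 : ℝ))
    le_rfl hZw hM
  exact klb1gd_dominance_union (a₂ := (-0.1775 : ℝ)) (b₂ := (-0.075)) le_rfl h1 hDw

/-- The extended-window margin is positive: `γ = min (min γ_Z γ_ABC) γ_D > 0` (kernel decision on the five record rationals). [folklore] -/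
theorem klb1g_window_d005_d025_gamma_pos :
    0 < min (min klCertB1gWinZ.gamma (min (min klCertB1gWinA.gamma klCertB1gWinB.gamma) klCertB1gWinC.gamma))
      klCertB1gWinD.gamma := by
  decide +kernel

end Summit.HubbardSuperconductivity.HubbardSuperconductivity.Theorems

end
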